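import Literature.NumberTheory.CubicFields.DivisibleOrbitFamilies
import Literature.NumberTheory.CubicFields.ShintaniDualDensityBounds
import Literature.NumberTheory.CubicFields.UniformityMaximalReductionProofs
import Literature.NumberTheory.Sieve.DivisorBound
import HarnessLib

/-!
# The dual-coefficient sums `Σ_{n<N} Σ_α a^α(|Φ̂|, n)` as weighted counts of typed orbits (towards BTT Prop. 5.1)

Topic `Literature/NumberTheory/CubicFields`; built on `ShintaniDualDensity(Bounds).lean` (the dual weight
`dualWeight Φ f = 𝟙_{V̂}(f)·|Φ̂(f)|`, the coefficients `dualAbsCoeff Φ α n = a^α(|Φ̂|, n)`, the partial densities),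
`DivisibleOrbitFamilies.lean` (the orbit families `divFam`, their content/overring recursion, the terminal shape
`DivCountBound`), `UniformityMaximalReductionProofs.lean` (`#maxOrbits ∅ = Σ h(D)` over `q² ∣ D`, for Prop. 4.5) and
the divisor bound of `Sieve/DivisorBound.lean`. Everything here is PROVED; the definitions are explicit finite
combinatorial objects (sets of orbits, types `τ = (c₂, c₁, d₄, d₃)`, weights).

Bhargava–Taniguchi–Thorne 2023, proof of Prop. 5.1 (p. 16), after Prop. 5.2: "for each squarefree `q`, and every
`x ∈ V(ℤ)`, factor `q = c₂c₁d₄d₃d₂d₁d₀` [here `d₂, d₁, d₀` are absorbed: only the primes where `Φ̂ ≠ 0` matter] …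
the total contribution to `N q⁸ Σ_{α,n<N} a^α(|Ψ̂_{q²}|, n)` … is `N q⁸` times
`∏_{p∣c₁} O(p⁻³) ∏_{p∣d₄} (p⁻³ + O(p⁻⁴)) ∏_{p∣d₃} O(p⁻⁴) …` [the per-prime majorants] times the number of
`GL₂(ℤ)`-orbits of `x` with `0 < |Disc(x)| < N` satisfying the divisibility/non-maximality conditions", then the
two ranges `N ≤ Q^{100}` (dyadic blocks `[D₃, 2D₃]` of `d₃`, the divisor bound, Prop. 4.5) and `N > Q^{100}`
(Prop. 4.7). This file provides, for ANY `GL₂`-invariant weight `Φ` on `V(ℤ/Mℤ)` whose dual transform is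
majorised prime-by-prime (`hmaj : ‖dualWeight Φ f‖ ≤ ∏_{p∈P} localMajorant p f`, the output of Prop. 5.2):

* `sum_re_dualAbsCoeff_le` — `Σ_{n<N} Σ_α Re a^α(|Φ̂|, n) ≤ Σ_{τ ∈ [1,B]⁴, ∏τ = ∏P} wt(τ) · Σ_α #divFam α (N/(c₂²c₁)⁴) 1 1 P₄ P₃`
  with `wt(c₂,c₁,d₄,d₃) = 9^{ω(c₁)} c₁⁻³ d₄⁻³ d₃⁻⁴` (regrouping by orbits, the type of an orbit, content division);
* `cnt_large_le`, `weight_mul_cnt_large_le`, `typeSum_large_le` — the large range: peel `d₃`, run the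
  `P₄`-recursion with the terminal count `DivCountBound C_B K_B`; per type `≤ 2C_B 14^{ω(u)} N/u⁷`, `u = ∏τ`;
* `blockSum_le`, `blockSum_empty_le_terminal` — the small range: the `d₃`-summed counts over a block obey the same
  recursion with terminal bound from the divisor bound (`τ(n) ≤ C_δ n^δ`) and Prop. 4.5 (`btt_uniformity_sqDvd`);
* `bigPrimes q`, `roughPart q = u(q)`, `tupleBox B = [1,B]⁴` and the bookkeeping of types (`q ≤ 6u(q)`, at most `τ(u)³`
  types of product `u`).

The sums over `q ∈ [Q, 2Q]`, the supremum over `N` and the `ε`-bookkeeping are in `DualDensityPsiSum.lean`.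

## References

* M. Bhargava, T. Taniguchi, F. Thorne, *Improved error estimates for the Davenport–Heilbronn theorems*,
  Math. Ann. 389 (2024) = arXiv:2107.12819, §5 (proof of Prop. 5.1), Lemma 2.3, Props. 4.5, 4.7 [BhargavaTaniguchiThorne2023].
-/

noncomputable section

namespace Literature.NumberTheory.CubicFields

open BinaryCubic Finset Classical
open Literature.NumberTheory.Sieve.FriedlanderIwaniecPrimesSquarefree (squarefree_prod_of_primes)

/-! ### Orbit sums: from the dual coefficients to counts of typed orbits -/

section OrbitSums

/-- The finite set of `GL₂(ℤ)`-orbits with `0 < α·Disc < Y`. [folklore] -/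
def windowOrbits (α : ℤ) (Y : ℝ) : Finset (Set (BinaryCubic ℤ)) := (finite_setOf_inWindow α Y).toFinset

/-- Membership in `windowOrbits`. [folklore] -/
theorem mem_windowOrbits {α : ℤ} {Y : ℝ} {O : Set (BinaryCubic ℤ)} :
    O ∈ windowOrbits α Y ↔ ∃ f, O = gl2zOrbit f ∧ InWindow α Y f.disc := by
  rw [windowOrbits, Set.Finite.mem_toFinset, Set.mem_setOf_eq]

/-- The two representatives of an orbit are equivalent. [folklore] -/
theorem gl2zEquiv_orbitRep_repOf {D : ℤ} (O : orbitsOfDisc D) : GL2ZEquiv (orbitRep O) (repOf O.1) := by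
  have h2 := gl2zEquiv_repOf (orbitRep O)
  rwa [← (orbitRep_spec O).1] at h2

/-- The discriminant of the representative of the orbit of `f` is `Disc f`. [folklore] -/
theorem disc_repOf_of_eq {O : Set (BinaryCubic ℤ)} {f : BinaryCubic ℤ} (h : O = gl2zOrbit f) : (repOf O).disc = f.disc := by
  have h2 := gl2zEquiv_repOf f
  rw [← h] at h2
  exact h2.disc_eq

/-- **`Re a^α(|Φ̂|, n) ≤ Σ_{orbits of disc αn} |Φ̂(rep)|`** (drop `1/|Stab| ≤ 1`; the dual weight is an orbit invariant). [folklore] -/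
theorem re_dualAbsCoeff_le {M : ℕ} [NeZero M] {Φ : BinaryCubic (ZMod M) → ℂ}
    (hΦ : ∀ γ : Matrix (Fin 2) (Fin 2) (ZMod M), IsUnit γ.det → ∀ y, Φ (twist γ y) = Φ y)
    {α : ℤ} {n : ℕ} (hD : (α * n : ℤ) ≠ 0) :
    (dualAbsCoeff Φ α n).re ≤ ∑ᶠ O : orbitsOfDisc (α * n), ‖dualWeight Φ (repOf O.1)‖ := by
  haveI := finite_orbitsOfDisc hD
  haveI : Fintype (orbitsOfDisc (α * n)) := Fintype.ofFinite _
  unfold dualAbsCoeff shintaniCoeffWith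
  rw [finsum_eq_sum_of_fintype, finsum_eq_sum_of_fintype, Complex.re_sum]
  refine Finset.sum_le_sum fun O _ => ?_
  rw [dualWeight_eq_of_gl2zEquiv hΦ (gl2zEquiv_orbitRep_repOf O)]
  calc (dualWeight Φ (repOf O.1) / (stabCard (orbitRep O) : ℂ)).re
      ≤ ‖dualWeight Φ (repOf O.1) / (stabCard (orbitRep O) : ℂ)‖ := Complex.re_le_norm _
    _ = ‖dualWeight Φ (repOf O.1)‖ / (stabCard (orbitRep O) : ℝ) := by rw [norm_div, Complex.norm_natCast]
    _ ≤ ‖dualWeight Φ (repOf O.1)‖ := by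
        rcases Nat.eq_zero_or_pos (stabCard (orbitRep O)) with h0 | hpos
        · rw [h0, Nat.cast_zero, div_zero]; exact norm_nonneg _
        · exact div_le_self (norm_nonneg _) (by exact_mod_cast hpos)

/-- **Regrouping `Σ_{1 ≤ n < N} Σ_{orbits of disc αn} G = Σ_{orbits with 0 < α Disc < N} G`.** [folklore] -/
theorem sum_Ico_finsum_orbitsOfDisc_eq {α : ℤ} (hα : α = 1 ∨ α = -1) (N : ℕ) (G : Set (BinaryCubic ℤ) → ℝ) :
    ∑ n ∈ Finset.Ico 1 N, ∑ᶠ O : orbitsOfDisc (α * n), G O.1 = ∑ O ∈ windowOrbits α N, G O := by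
  have hαα : α * α = 1 := by rcases hα with rfl | rfl <;> norm_num
  have key : ∀ O ∈ windowOrbits α (N : ℝ), (α * (repOf O).disc).toNat ∈ Finset.Ico 1 N := by
    intro O hO
    obtain ⟨f, hOf, h0, hY⟩ := mem_windowOrbits.mp hO
    rw [disc_repOf_of_eq hOf, Finset.mem_Ico]
    have h1 : ((α * f.disc).toNat : ℤ) = α * f.disc := Int.toNat_of_nonneg h0.le
    constructor
    · have : (1 : ℤ) ≤ (α * f.disc).toNat := by rw [h1]; exact h0
      exact_mod_cast this
    · have h2 : (((α * f.disc).toNat : ℤ) : ℝ) < N := by rw [h1]; exact hY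
      rw [Int.cast_natCast] at h2
      exact_mod_cast h2
  rw [← Finset.sum_fiberwise_of_maps_to key G]
  refine Finset.sum_congr rfl fun n hn => ?_
  have hn1 : 1 ≤ n := (Finset.mem_Ico.mp hn).1
  have hD : (α * n : ℤ) ≠ 0 := by
    rcases hα with rfl | rfl
    · simp; omega
    · simp; omega
  haveI := finite_orbitsOfDisc hD
  haveI : Fintype (orbitsOfDisc (α * n)) := Fintype.ofFinite _
  rw [finsum_eq_sum_of_fintype]
  symm
  refine Finset.sum_subtype _ (fun O => ?_) G
  rw [Finset.mem_filter, mem_windowOrbits]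
  constructor
  · rintro ⟨⟨f, hOf, hw⟩, hnO⟩
    refine ⟨f, hOf, ?_⟩
    have h1 : ((α * f.disc).toNat : ℤ) = α * f.disc := Int.toNat_of_nonneg hw.1.le
    rw [disc_repOf_of_eq hOf] at hnO
    have h2 : α * f.disc = n := by rw [← h1, hnO]
    calc f.disc = α * (α * f.disc) := by rw [← mul_assoc, hαα, one_mul]
      _ = α * n := by rw [h2]
  · rintro ⟨f, hOf, hdisc⟩
    have hαD : α * f.disc = n := by rw [hdisc, ← mul_assoc, hαα, one_mul]
    refine ⟨⟨f, hOf, ?_, ?_⟩, ?_⟩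
    · rw [hαD]; exact_mod_cast hn1
    · rw [hαD]; push_cast; exact_mod_cast (Finset.mem_Ico.mp hn).2
    · rw [disc_repOf_of_eq hOf, hαD]; exact Int.toNat_natCast n

/-- Class "`p² ∣ ct(f)`". [folklore] -/
def ClsC2 (f : BinaryCubic ℤ) (p : ℕ) : Prop := f.IsMultiple ((p : ℤ) ^ 2)

/-- Class "`p ∣ ct(f)`". [folklore] -/
def ClsC1 (f : BinaryCubic ℤ) (p : ℕ) : Prop := f.IsMultiple p

/-- Class "`f ∉ U_p`, `p⁴ ∣ Disc f`". [folklore] -/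
def ClsD4 (f : BinaryCubic ℤ) (p : ℕ) : Prop := ¬ f.MemU p ∧ (p : ℤ) ^ 4 ∣ f.disc

/-- Class "`f ∉ U_p`, `p³ ∣ Disc f`". [folklore] -/
def ClsD3 (f : BinaryCubic ℤ) (p : ℕ) : Prop := ¬ f.MemU p ∧ (p : ℤ) ^ 3 ∣ f.disc

/-- **The per-prime majorant of `|Ψ̂_{p²}(f)|`** (BTT Prop. 5.2, second definition of `Ψ`, `p ≥ 5`): `1` if `p² ∣ f`;
`9p⁻³` if `p ∥ ct(f)`; `p⁻³` if `p ∤ f`, `f ∉ U_p`, `p⁴ ∣ Disc f`; `p⁻⁴` if `p ∤ f`, `f ∉ U_p`, `p³ ∣ Disc f`; `0` otherwise.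
[cite: BhargavaTaniguchiThorne2023, Prop. 5.2 (the five cases)] -/
def localMajorant (p : ℕ) (f : BinaryCubic ℤ) : ℝ :=
  if ClsC2 f p then 1
  else if ClsC1 f p then 9 * ((p : ℝ) ^ 3)⁻¹
  else if ClsD4 f p then ((p : ℝ) ^ 3)⁻¹
  else if ClsD3 f p then ((p : ℝ) ^ 4)⁻¹
  else 0

/-- The majorant is nonnegative. [folklore] -/
theorem localMajorant_nonneg (p : ℕ) (f : BinaryCubic ℤ) : 0 ≤ localMajorant p f := by
  unfold localMajorant; split_ifs <;> positivity

/-- **The weight of a factorisation type `τ = (c₂, c₁, d₄, d₃)`: `9^{ω(c₁)} c₁⁻³ d₄⁻³ d₃⁻⁴`** (BTT's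
`1/(c₂² c₁³ d₄³ d₃⁴ d₂⁵)` after the substitution `x ↦ x/c₂²c₁`, for our `Ψ` where the case `d₂` is empty).
[cite: BhargavaTaniguchiThorne2023, §5 (eq. total_contribution)] -/
def tupleWeight (τ : ℕ × ℕ × ℕ × ℕ) : ℝ :=
  9 ^ τ.2.1.primeFactors.card * ((τ.2.1 : ℝ) ^ 3)⁻¹ * ((τ.2.2.1 : ℝ) ^ 3)⁻¹ * ((τ.2.2.2 : ℝ) ^ 4)⁻¹

/-- The weight is nonnegative. [folklore] -/
theorem tupleWeight_nonneg (τ : ℕ × ℕ × ℕ × ℕ) : 0 ≤ tupleWeight τ := by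
  unfold tupleWeight; positivity

/-- **The type conditions of `τ = (c₂, c₁, d₄, d₃)` for a form `f`, relative to the set of primes `P`**:
`c₂c₁d₄d₃ = ∏P`, `c₂²c₁ ∣ f`, and the conditions `DivCond` at the primes of `d₄` (`f ∉ U_p`, `p⁴ ∣ Disc`) and
of `d₃` (`f ∉ U_p`, `p³ ∣ Disc`, `p⁴ ∤ Disc`). [cite: BhargavaTaniguchiThorne2023, §5 (the factorisation q = c₂c₁d₄d₃d₂)] -/
def TupleCond (P : Finset ℕ) (τ : ℕ × ℕ × ℕ × ℕ) (f : BinaryCubic ℤ) : Prop :=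
  τ.1 * τ.2.1 * τ.2.2.1 * τ.2.2.2 = ∏ p ∈ P, p ∧ f.IsMultiple ((τ.1 : ℤ) ^ 2 * τ.2.1) ∧
    (∀ p ∈ τ.2.2.1.primeFactors, ¬ f.MemU p ∧ (p : ℤ) ^ 4 ∣ f.disc) ∧
    (∀ p ∈ τ.2.2.2.primeFactors, ¬ f.MemU p ∧ (p : ℤ) ^ 3 ∣ f.disc ∧ ¬ (p : ℤ) ^ 4 ∣ f.disc)

/-- The box of types `[1, B]⁴`. [folklore] -/
def tupleBox (B : ℕ) : Finset (ℕ × ℕ × ℕ × ℕ) :=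
  Finset.Icc 1 B ×ˢ (Finset.Icc 1 B ×ˢ (Finset.Icc 1 B ×ˢ Finset.Icc 1 B))

/-- Membership in the box `[1, B]⁴`. [folklore] -/
theorem mem_tupleBox {B : ℕ} {τ : ℕ × ℕ × ℕ × ℕ} :
    τ ∈ tupleBox B ↔ (1 ≤ τ.1 ∧ τ.1 ≤ B) ∧ (1 ≤ τ.2.1 ∧ τ.2.1 ≤ B) ∧ (1 ≤ τ.2.2.1 ∧ τ.2.2.1 ≤ B) ∧
      (1 ≤ τ.2.2.2 ∧ τ.2.2.2 ≤ B) := by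
  simp only [tupleBox, Finset.mem_product, Finset.mem_Icc]

/-- Prime-power divisibilities at distinct primes combine. [folklore] -/
theorem isMultiple_prod_pow {S : Finset ℕ} (hS : ∀ p ∈ S, p.Prime) (e : ℕ → ℕ) {f : BinaryCubic ℤ}
    (h : ∀ p ∈ S, f.IsMultiple ((p : ℤ) ^ e p)) : f.IsMultiple (∏ p ∈ S, (p : ℤ) ^ e p) := by
  have hcop : (S : Set ℕ).Pairwise (Function.onFun IsCoprime fun p => (p : ℤ) ^ e p) := by
    intro p hp q hq hpq
    exact (Nat.isCoprime_iff_coprime.mpr ((Nat.coprime_primes (hS p hp) (hS q hq)).mpr hpq)).pow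
  exact ⟨Finset.prod_dvd_of_coprime hcop fun p hp => (h p hp).1,
    Finset.prod_dvd_of_coprime hcop fun p hp => (h p hp).2.1,
    Finset.prod_dvd_of_coprime hcop fun p hp => (h p hp).2.2.1,
    Finset.prod_dvd_of_coprime hcop fun p hp => (h p hp).2.2.2⟩

/-- **Pointwise: `∏_{p ∈ P} (majorant at p) ≤ Σ_{τ ∈ [1,B]⁴} [TupleCond P τ f] · tupleWeight τ`** (`∏P ≤ B`): if some
factor vanishes the product is `0`; otherwise the primes of `P` fall into the four classes and the product is the
weight of the type `τ(f) = (∏P₀, ∏P₁, ∏P₄, ∏P₃)`, whose conditions `f` satisfies. [folklore] -/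
theorem prod_localMajorant_le_sum {P : Finset ℕ} (hP : ∀ p ∈ P, p.Prime) {B : ℕ} (hB : ∏ p ∈ P, p ≤ B)
    (f : BinaryCubic ℤ) :
    ∏ p ∈ P, localMajorant p f ≤ ∑ τ ∈ tupleBox B, (if TupleCond P τ f then tupleWeight τ else 0) := by
  have hnn : ∀ τ ∈ tupleBox B, (0 : ℝ) ≤ if TupleCond P τ f then tupleWeight τ else 0 := fun τ _ => by
    split_ifs
    · exact tupleWeight_nonneg τ
    · exact le_rfl
  by_cases hbad : ∃ p ∈ P, localMajorant p f = 0
  · obtain ⟨p, hp, h0⟩ := hbad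
    rw [Finset.prod_eq_zero hp h0]
    exact Finset.sum_nonneg hnn
  push Not at hbad
  -- the four classes, defined successively
  set Q0 := P.filter (ClsC2 f) with hQ0
  set R0 := P.filter (fun p => ¬ ClsC2 f p) with hR0
  set Q1 := R0.filter (ClsC1 f) with hQ1
  set R1 := R0.filter (fun p => ¬ ClsC1 f p) with hR1
  set Q4 := R1.filter (ClsD4 f) with hQ4
  set R2 := R1.filter (fun p => ¬ ClsD4 f p) with hR2
  set Q3 := R2.filter (ClsD3 f) with hQ3
  have hR3e : R2.filter (fun p => ¬ ClsD3 f p) = ∅ := by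
    rw [Finset.eq_empty_iff_forall_notMem]
    intro p hp
    simp only [hR2, hR1, hR0, Finset.mem_filter] at hp
    obtain ⟨⟨⟨⟨hpP, h0⟩, h1⟩, h4⟩, h3⟩ := hp
    apply hbad p hpP
    rw [localMajorant, if_neg h0, if_neg h1, if_neg h4, if_neg h3]
  -- the product over the classes
  have hsplit : ∀ (g : ℕ → ℝ), ∏ p ∈ P, g p = (∏ p ∈ Q0, g p) * (∏ p ∈ Q1, g p) * (∏ p ∈ Q4, g p) * (∏ p ∈ Q3, g p) := by
    intro g
    rw [← Finset.prod_filter_mul_prod_filter_not P (ClsC2 f), ← Finset.prod_filter_mul_prod_filter_not R0 (ClsC1 f),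
      ← Finset.prod_filter_mul_prod_filter_not R1 (ClsD4 f), ← Finset.prod_filter_mul_prod_filter_not R2 (ClsD3 f), hR3e,
      Finset.prod_empty]
    ring
  have hsplitN : ∏ p ∈ P, p = (∏ p ∈ Q0, p) * (∏ p ∈ Q1, p) * (∏ p ∈ Q4, p) * (∏ p ∈ Q3, p) := by
    rw [← Finset.prod_filter_mul_prod_filter_not P (ClsC2 f), ← Finset.prod_filter_mul_prod_filter_not R0 (ClsC1 f),
      ← Finset.prod_filter_mul_prod_filter_not R1 (ClsD4 f), ← Finset.prod_filter_mul_prod_filter_not R2 (ClsD3 f), hR3e,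
      Finset.prod_empty]
    ring
  -- subsets of P
  have hQ0P : Q0 ⊆ P := Finset.filter_subset _ _
  have hR0P : R0 ⊆ P := Finset.filter_subset _ _
  have hQ1P : Q1 ⊆ P := (Finset.filter_subset _ _).trans hR0P
  have hR1P : R1 ⊆ P := (Finset.filter_subset _ _).trans hR0P
  have hQ4P : Q4 ⊆ P := (Finset.filter_subset _ _).trans hR1P
  have hR2P : R2 ⊆ P := (Finset.filter_subset _ _).trans hR1P
  have hQ3P : Q3 ⊆ P := (Finset.filter_subset _ _).trans hR2P
  -- the values of the majorant on the classes
  have v0 : ∀ p ∈ Q0, localMajorant p f = 1 := fun p hp => by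
    have h0 : ClsC2 f p := (Finset.mem_filter.mp hp).2
    rw [localMajorant, if_pos h0]
  have v1 : ∀ p ∈ Q1, localMajorant p f = 9 * ((p : ℝ) ^ 3)⁻¹ := fun p hp => by
    obtain ⟨hpa, h1⟩ := Finset.mem_filter.mp hp
    have h0 : ¬ ClsC2 f p := (Finset.mem_filter.mp hpa).2
    rw [localMajorant, if_neg h0, if_pos h1]
  have v4 : ∀ p ∈ Q4, localMajorant p f = ((p : ℝ) ^ 3)⁻¹ := fun p hp => by
    obtain ⟨hpa, h4⟩ := Finset.mem_filter.mp hp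
    obtain ⟨hpb, h1⟩ := Finset.mem_filter.mp hpa
    have h0 : ¬ ClsC2 f p := (Finset.mem_filter.mp hpb).2
    rw [localMajorant, if_neg h0, if_neg h1, if_pos h4]
  have v3 : ∀ p ∈ Q3, localMajorant p f = ((p : ℝ) ^ 4)⁻¹ := fun p hp => by
    obtain ⟨hpa, h3⟩ := Finset.mem_filter.mp hp
    obtain ⟨hpb, h4⟩ := Finset.mem_filter.mp hpa
    obtain ⟨hpc, h1⟩ := Finset.mem_filter.mp hpb
    have h0 : ¬ ClsC2 f p := (Finset.mem_filter.mp hpc).2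
    rw [localMajorant, if_neg h0, if_neg h1, if_neg h4, if_pos h3]
  -- the type of f
  set τ₀ : ℕ × ℕ × ℕ × ℕ := (∏ p ∈ Q0, p, ∏ p ∈ Q1, p, ∏ p ∈ Q4, p, ∏ p ∈ Q3, p) with hτ₀
  have hcond : TupleCond P τ₀ f := by
    refine ⟨hsplitN.symm, ?_, ?_, ?_⟩
    · -- `c₂² c₁ ∣ f`
      have hdisj : Disjoint Q0 Q1 := by
        rw [Finset.disjoint_left]
        intro p hp0 hp1
        exact (Finset.mem_filter.mp (Finset.mem_filter.mp hp1).1).2 (Finset.mem_filter.mp hp0).2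
      let ex : ℕ → ℕ := fun p => if ClsC2 f p then 2 else 1
      have hex0 : ∀ p ∈ Q0, ex p = 2 := fun p hp => if_pos (Finset.mem_filter.mp hp).2
      have hex1 : ∀ p ∈ Q1, ex p = 1 := fun p hp => if_neg (Finset.mem_filter.mp (Finset.mem_filter.mp hp).1).2
      have e : ((∏ p ∈ Q0, p : ℕ) : ℤ) ^ 2 * ((∏ p ∈ Q1, p : ℕ) : ℤ) = ∏ p ∈ Q0 ∪ Q1, (p : ℤ) ^ ex p := by
        have h0' : ∏ p ∈ Q0, (p : ℤ) ^ ex p = ∏ p ∈ Q0, (p : ℤ) ^ 2 :=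
          Finset.prod_congr rfl (fun p hp => by rw [hex0 p hp])
        have h1' : ∏ p ∈ Q1, (p : ℤ) ^ ex p = ∏ p ∈ Q1, (p : ℤ) :=
          Finset.prod_congr rfl (fun p hp => by rw [hex1 p hp, pow_one])
        rw [Finset.prod_union hdisj, h0', h1', Finset.prod_pow]
        push_cast
        ring
      show f.IsMultiple (((∏ p ∈ Q0, p : ℕ) : ℤ) ^ 2 * ((∏ p ∈ Q1, p : ℕ) : ℤ))
      rw [e]
      refine isMultiple_prod_pow (fun p hp => hP p ((Finset.union_subset hQ0P hQ1P) hp)) ex fun p hp => ?_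
      rcases Finset.mem_union.mp hp with hp0 | hp1
      · rw [hex0 p hp0]; exact (Finset.mem_filter.mp hp0).2
      · rw [hex1 p hp1, pow_one]; exact (Finset.mem_filter.mp hp1).2
    · intro p hp
      have hp' : p ∈ Q4 := by rwa [Nat.primeFactors_prod (fun p hp => hP p (hQ4P hp))] at hp
      exact (Finset.mem_filter.mp hp').2
    · intro p hp
      have hp' : p ∈ Q3 := by rwa [Nat.primeFactors_prod (fun p hp => hP p (hQ3P hp))] at hp
      obtain ⟨hpa, h3⟩ := Finset.mem_filter.mp hp'
      obtain ⟨-, h4⟩ := Finset.mem_filter.mp hpa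
      exact ⟨h3.1, h3.2, fun h => h4 ⟨h3.1, h⟩⟩
  have hmem : τ₀ ∈ tupleBox B := by
    have hb : ∀ S ⊆ P, 1 ≤ ∏ p ∈ S, p ∧ ∏ p ∈ S, p ≤ B := fun S hS =>
      ⟨Nat.one_le_iff_ne_zero.mpr (Finset.prod_ne_zero_iff.mpr fun p hp => (hP p (hS hp)).ne_zero),
        (Finset.prod_le_prod_of_subset_of_one_le' hS fun p hp _ => (hP p hp).one_lt.le).trans hB⟩
    exact mem_tupleBox.mpr ⟨hb Q0 hQ0P, hb Q1 hQ1P, hb Q4 hQ4P, hb Q3 hQ3P⟩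
  have hval : ∏ p ∈ P, localMajorant p f = tupleWeight τ₀ := by
    rw [hsplit, Finset.prod_congr rfl v0, Finset.prod_congr rfl v1, Finset.prod_congr rfl v4, Finset.prod_congr rfl v3,
      tupleWeight]
    simp only [hτ₀]
    rw [Nat.primeFactors_prod (fun p hp => hP p (hQ1P hp)), Finset.prod_const_one, one_mul, Finset.prod_mul_distrib,
      Finset.prod_const]
    push_cast
    rw [Finset.prod_inv_distrib, Finset.prod_inv_distrib, Finset.prod_inv_distrib, ← Finset.prod_pow, ← Finset.prod_pow,
      ← Finset.prod_pow]
  calc ∏ p ∈ P, localMajorant p f = (if TupleCond P τ₀ f then tupleWeight τ₀ else 0) := by rw [if_pos hcond, hval]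
    _ ≤ ∑ τ ∈ tupleBox B, (if TupleCond P τ f then tupleWeight τ else 0) := Finset.single_le_sum hnn hmem

/-- From `c₂c₁d₄d₃ = ∏P` (squarefree): the coprimalities used for content division. [folklore] -/
theorem coprime_of_tuple_prod {c₂ c₁ d₄ d₃ : ℕ} {P : Finset ℕ} (hP : ∀ p ∈ P, p.Prime)
    (h : c₂ * c₁ * d₄ * d₃ = ∏ p ∈ P, p) :
    (c₂ ^ 2 * c₁).Coprime d₄ ∧ (c₂ ^ 2 * c₁).Coprime d₃ ∧ d₄.Coprime d₃ ∧ 0 < c₂ ^ 2 * c₁ := by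
  have hsq : Squarefree (c₂ * c₁ * d₄ * d₃) := h ▸ squarefree_prod_of_primes hP
  obtain ⟨h123_4, h123, -⟩ := Nat.squarefree_mul_iff.mp hsq
  obtain ⟨h12_4, h12, -⟩ := Nat.squarefree_mul_iff.mp h123
  have hne : c₂ * c₁ ≠ 0 := h12.ne_zero
  obtain ⟨hc₂, hc₁⟩ := mul_ne_zero_iff.mp hne
  have hdvd : c₂ ^ 2 * c₁ ∣ (c₂ * c₁) ^ 2 := ⟨c₁, by ring⟩
  refine ⟨Nat.Coprime.coprime_dvd_left hdvd (h12_4.pow_left 2),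
    Nat.Coprime.coprime_dvd_left hdvd ((Nat.Coprime.coprime_mul_right h123_4).pow_left 2),
    Nat.Coprime.coprime_mul_left h123_4, Nat.pos_of_ne_zero (mul_ne_zero (pow_ne_zero 2 hc₂) hc₁)⟩

/-- A prime dividing `b` does not divide `a` when `a, b` are coprime. [folklore] -/
theorem not_dvd_of_coprime_of_dvd {a b ℓ : ℕ} (hab : a.Coprime b) (hℓ : ℓ.Prime) (hb : ℓ ∣ b) : ¬ ℓ ∣ a := fun ha =>
  hℓ.one_lt.ne' (Nat.dvd_one.mp (hab.gcd_eq_one ▸ Nat.dvd_gcd ha hb))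

/-- **Counting the orbits of a given type**: the orbits `O` in the window whose representative satisfies
`TupleCond P τ` inject (content division by `c₂²c₁`) into `divFam α (N/(c₂²c₁)⁴) 1 1 P₄ P₃` with `P₄, P₃` the primes
of `d₄, d₃` — and there are none unless `c₂c₁d₄d₃ = ∏P`. [folklore] -/
theorem card_filter_tupleCond_le {α : ℤ} {P : Finset ℕ} (hP : ∀ p ∈ P, p.Prime) (N : ℕ) (τ : ℕ × ℕ × ℕ × ℕ) :
    (((windowOrbits α N).filter (fun O => TupleCond P τ (repOf O))).card : ℝ) ≤
      if τ.1 * τ.2.1 * τ.2.2.1 * τ.2.2.2 = ∏ p ∈ P, p then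
        ((divFam α ((N : ℝ) / ((τ.1 ^ 2 * τ.2.1 : ℕ) : ℝ) ^ 4) 1 1 τ.2.2.1.primeFactors τ.2.2.2.primeFactors).ncard : ℝ)
      else 0 := by
  obtain ⟨c₂, c₁, d₄, d₃⟩ := τ
  dsimp only
  split_ifs with hprod
  · obtain ⟨hc4, hc3, -, hcpos⟩ := coprime_of_tuple_prod hP hprod
    have hsub : (↑((windowOrbits α N).filter (fun O => TupleCond P (c₂, c₁, d₄, d₃) (repOf O))) : Set (Set (BinaryCubic ℤ))) ⊆
        {O ∈ divFam α N 1 1 d₄.primeFactors d₃.primeFactors | (repOf O).IsMultiple ((c₂ ^ 2 * c₁ : ℕ) : ℤ)} := by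
      intro O hO
      rw [Finset.mem_coe, Finset.mem_filter, mem_windowOrbits] at hO
      obtain ⟨⟨f, hOf, hw⟩, -, hmul, h4, h3⟩ := hO
      refine ⟨⟨repOf O, eq_gl2zOrbit_repOf ⟨f, hOf⟩, ?_, by simp, by simp, h4, h3⟩, by push_cast; exact hmul⟩
      rwa [disc_repOf_of_eq hOf]
    have hfin : {O ∈ divFam α N 1 1 d₄.primeFactors d₃.primeFactors | (repOf O).IsMultiple ((c₂ ^ 2 * c₁ : ℕ) : ℤ)}.Finite :=
      (divFam_finite _ _ _ _ _ _).subset (Set.sep_subset _ _)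
    calc (((windowOrbits α N).filter (fun O => TupleCond P (c₂, c₁, d₄, d₃) (repOf O))).card : ℝ)
        = ((↑((windowOrbits α N).filter (fun O => TupleCond P (c₂, c₁, d₄, d₃) (repOf O))) : Set (Set (BinaryCubic ℤ))).ncard : ℝ) := by
          rw [Set.ncard_coe_finset]
      _ ≤ ({O ∈ divFam α N 1 1 d₄.primeFactors d₃.primeFactors | (repOf O).IsMultiple ((c₂ ^ 2 * c₁ : ℕ) : ℤ)}.ncard : ℝ) := by
          exact_mod_cast Set.ncard_le_ncard hsub hfin
      _ ≤ ((divFam α ((N : ℝ) / ((c₂ ^ 2 * c₁ : ℕ) : ℝ) ^ 4) 1 1 d₄.primeFactors d₃.primeFactors).ncard : ℝ) := by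
          exact_mod_cast ncard_sep_isMultiple_le hcpos (Nat.coprime_one_right _) (Nat.coprime_one_right _)
            (fun ℓ hℓ => ⟨Nat.prime_of_mem_primeFactors hℓ,
              not_dvd_of_coprime_of_dvd hc4 (Nat.prime_of_mem_primeFactors hℓ) (Nat.dvd_of_mem_primeFactors hℓ)⟩)
            (fun ℓ hℓ => ⟨Nat.prime_of_mem_primeFactors hℓ,
              not_dvd_of_coprime_of_dvd hc3 (Nat.prime_of_mem_primeFactors hℓ) (Nat.dvd_of_mem_primeFactors hℓ)⟩)
  · have he : (windowOrbits α N).filter (fun O => TupleCond P (c₂, c₁, d₄, d₃) (repOf O)) = ∅ :=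
      Finset.filter_eq_empty_iff.mpr fun O _ h => hprod h.1
    rw [he, Finset.card_empty, Nat.cast_zero]

/-- **The orbit-sum bound for one invariant weight.** If `|Φ̂|` on `V(ℤ)` is majorised by `∏_{p ∈ P}` of the
per-prime majorants, then
`Σ_{1 ≤ n < N} Σ_α Re a^α(|Φ̂|, n) ≤ Σ_{τ = (c₂,c₁,d₄,d₃) ∈ [1,B]⁴, c₂c₁d₄d₃ = ∏P} 9^{ω(c₁)} c₁⁻³ d₄⁻³ d₃⁻⁴ ·
Σ_α #divFam α (N/(c₂²c₁)⁴) 1 1 P₄ P₃` — BTT (eq. total_contribution) before the overring step.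
[cite: BhargavaTaniguchiThorne2023, §5 (eq. total_contribution)] -/
theorem sum_re_dualAbsCoeff_le {M : ℕ} [NeZero M] {Φ : BinaryCubic (ZMod M) → ℂ}
    (hΦ : ∀ γ : Matrix (Fin 2) (Fin 2) (ZMod M), IsUnit γ.det → ∀ y, Φ (twist γ y) = Φ y)
    {P : Finset ℕ} (hP : ∀ p ∈ P, p.Prime) (hmaj : ∀ f, ‖dualWeight Φ f‖ ≤ ∏ p ∈ P, localMajorant p f)
    {B : ℕ} (hB : ∏ p ∈ P, p ≤ B) (N : ℕ) :
    ∑ n ∈ Finset.Ico 1 N, ((dualAbsCoeff Φ 1 n).re + (dualAbsCoeff Φ (-1) n).re) ≤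
      ∑ τ ∈ tupleBox B, (if τ.1 * τ.2.1 * τ.2.2.1 * τ.2.2.2 = ∏ p ∈ P, p then tupleWeight τ else 0) *
        (((divFam 1 ((N : ℝ) / ((τ.1 ^ 2 * τ.2.1 : ℕ) : ℝ) ^ 4) 1 1 τ.2.2.1.primeFactors τ.2.2.2.primeFactors).ncard : ℝ) +
         ((divFam (-1) ((N : ℝ) / ((τ.1 ^ 2 * τ.2.1 : ℕ) : ℝ) ^ 4) 1 1 τ.2.2.1.primeFactors τ.2.2.2.primeFactors).ncard : ℝ)) := by
  have key : ∀ α : ℤ, (α = 1 ∨ α = -1) →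
      ∑ n ∈ Finset.Ico 1 N, (dualAbsCoeff Φ α n).re ≤
        ∑ τ ∈ tupleBox B, (if τ.1 * τ.2.1 * τ.2.2.1 * τ.2.2.2 = ∏ p ∈ P, p then tupleWeight τ else 0) *
          ((divFam α ((N : ℝ) / ((τ.1 ^ 2 * τ.2.1 : ℕ) : ℝ) ^ 4) 1 1 τ.2.2.1.primeFactors τ.2.2.2.primeFactors).ncard : ℝ) := by
    intro α hα
    calc ∑ n ∈ Finset.Ico 1 N, (dualAbsCoeff Φ α n).re
        ≤ ∑ n ∈ Finset.Ico 1 N, ∑ᶠ O : orbitsOfDisc (α * n), ‖dualWeight Φ (repOf O.1)‖ := by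
          refine Finset.sum_le_sum fun n hn => re_dualAbsCoeff_le hΦ ?_
          have hn1 : 1 ≤ n := (Finset.mem_Ico.mp hn).1
          rcases hα with rfl | rfl
          · simp; omega
          · simp; omega
      _ = ∑ O ∈ windowOrbits α N, ‖dualWeight Φ (repOf O)‖ :=
          sum_Ico_finsum_orbitsOfDisc_eq hα N (fun O => ‖dualWeight Φ (repOf O)‖)
      _ ≤ ∑ O ∈ windowOrbits α N, ∑ τ ∈ tupleBox B, (if TupleCond P τ (repOf O) then tupleWeight τ else 0) :=
          Finset.sum_le_sum fun O _ => (hmaj _).trans (prod_localMajorant_le_sum hP hB _)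
      _ = ∑ τ ∈ tupleBox B, ∑ O ∈ windowOrbits α N, (if TupleCond P τ (repOf O) then tupleWeight τ else 0) :=
          Finset.sum_comm
      _ = ∑ τ ∈ tupleBox B, tupleWeight τ * (((windowOrbits α N).filter (fun O => TupleCond P τ (repOf O))).card : ℝ) := by
          refine Finset.sum_congr rfl fun τ _ => ?_
          rw [Finset.natCast_card_filter, Finset.mul_sum]
          refine Finset.sum_congr rfl fun O _ => ?_
          split_ifs <;> simp
      _ ≤ _ := by
          refine Finset.sum_le_sum fun τ _ => ?_
          have h := card_filter_tupleCond_le (α := α) hP N τ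
          by_cases hprod : τ.1 * τ.2.1 * τ.2.2.1 * τ.2.2.2 = ∏ p ∈ P, p
          · rw [if_pos hprod] at h ⊢
            exact mul_le_mul_of_nonneg_left h (tupleWeight_nonneg τ)
          · rw [if_neg hprod] at h ⊢
            rw [zero_mul]
            calc tupleWeight τ * (((windowOrbits α N).filter (fun O => TupleCond P τ (repOf O))).card : ℝ)
                ≤ tupleWeight τ * 0 := mul_le_mul_of_nonneg_left h (tupleWeight_nonneg τ)
              _ = 0 := mul_zero _
  rw [Finset.sum_add_distrib]
  refine (add_le_add (key 1 (Or.inl rfl)) (key (-1) (Or.inr rfl))).trans (le_of_eq ?_)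
  rw [← Finset.sum_add_distrib]
  exact Finset.sum_congr rfl fun τ _ => by ring


end OrbitSums

/-! ### The two regimes per type: `N` large (the `P₄`-recursion with `DivCountBound`) and `N` small (blocks of `d₃`) -/

section Regimes

/-- **Large regime, one type `τ = (c₂, c₁, d₄, d₃)`**: after peeling `d₃` (`3^{ω(d₃)}`, height `Y/d₃²`, `d₃ ∣ Disc`) the
`P₄`-recursion with the terminal count `DivCountBound` gives
`#divFam α Y 1 1 P₄ P₃ ≤ 3^{ω(d₃)} C 4^{ω(d₃)} 14^{ω(d₄)} · Y/(d₃³ d₄⁴)` for `Y ≥ K d₃⁷ d₄^{16}` — the factors `d₄⁻⁷ d₃⁻⁷`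
of BTT after multiplying by the weights `d₄⁻³ d₃⁻⁴`. [cite: BhargavaTaniguchiThorne2023, §5 (N > Q^{100}: "Prop. 4.7 more than suffices")] -/
theorem cnt_large_le {C_B K_B : ℝ} (hLT : DivCountBound C_B K_B) (hC : 0 ≤ C_B) (hK : 0 ≤ K_B)
    {α : ℤ} (hα : α = 1 ∨ α = -1) {c₂ c₁ d₄ d₃ : ℕ} {P : Finset ℕ} (hP : ∀ p ∈ P, p.Prime)
    (h6 : (∏ p ∈ P, p).Coprime 6) (hprod : c₂ * c₁ * d₄ * d₃ = ∏ p ∈ P, p) {Y : ℝ}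
    (hY : K_B * (d₃ : ℝ) ^ 7 * (d₄ : ℝ) ^ 16 ≤ Y) :
    ((divFam α Y 1 1 d₄.primeFactors d₃.primeFactors).ncard : ℝ) ≤
      3 ^ d₃.primeFactors.card * (C_B * 4 ^ d₃.primeFactors.card * 14 ^ d₄.primeFactors.card) *
        Y / ((d₃ : ℝ) ^ 3 * (d₄ : ℝ) ^ 4) := by
  -- arithmetic of the type
  have hsqu : Squarefree (c₂ * c₁ * d₄ * d₃) := hprod ▸ squarefree_prod_of_primes hP
  obtain ⟨h43', h123, hsq3⟩ := Nat.squarefree_mul_iff.mp hsqu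
  obtain ⟨-, -, hsq4⟩ := Nat.squarefree_mul_iff.mp h123
  have h43 : d₄.Coprime d₃ := Nat.Coprime.coprime_mul_left h43'
  have hd3 : ∏ p ∈ d₃.primeFactors, p = d₃ := Nat.prod_primeFactors_of_squarefree hsq3
  have hd4 : ∏ p ∈ d₄.primeFactors, p = d₄ := Nat.prod_primeFactors_of_squarefree hsq4
  have hpf4 : ∀ ℓ ∈ d₄.primeFactors, ℓ.Prime := fun ℓ hℓ => Nat.prime_of_mem_primeFactors hℓ
  have hpf3 : ∀ ℓ ∈ d₃.primeFactors, ℓ.Prime := fun ℓ hℓ => Nat.prime_of_mem_primeFactors hℓ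
  have hd30 : (0 : ℝ) < d₃ := by exact_mod_cast Nat.pos_of_ne_zero hsq3.ne_zero
  have hd40 : (0 : ℝ) < d₄ := by exact_mod_cast Nat.pos_of_ne_zero hsq4.ne_zero
  have h436 : (d₄ * d₃).Coprime 6 := Nat.Coprime.coprime_dvd_left ⟨c₂ * c₁, by rw [← hprod]; ring⟩ h6
  -- Step 1: peel `d₃`
  have h1 := ncard_divFam_P3_all (s := α) (m := 1) (P4 := d₄.primeFactors) hpf4 d₃.primeFactors Y 1 hpf3
    (Nat.Coprime.disjoint_primeFactors h43) (Nat.coprime_one_left _) (Nat.coprime_one_left _)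
  rw [hd3, one_mul] at h1
  -- Step 2: the `P₄`-recursion
  set A : ℝ := C_B * 4 ^ d₃.primeFactors.card / d₃ with hA
  have hA0 : 0 ≤ A := by rw [hA]; positivity
  have hrec := abstract_recursion_P4 (fun Y' m P => ((divFam α Y' m d₃ P ∅).ncard : ℝ)) hA0
    (show (1 : ℝ) ≤ 4 by norm_num) (show (0 : ℝ) ≤ K_B * (d₃ : ℝ) ^ 5 by positivity) d₄.primeFactors hpf4
    ?_ Y ?_ d₄.primeFactors (Y / (d₃ : ℝ) ^ 2) 1 subset_rfl (by rw [one_mul]) ?_ ?_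
  · -- combine
    rw [hd4, Nat.primeFactors_one, Finset.card_empty, pow_zero, mul_one, Nat.cast_one, one_pow, one_mul] at hrec
    calc ((divFam α Y 1 1 d₄.primeFactors d₃.primeFactors).ncard : ℝ)
        ≤ 3 ^ d₃.primeFactors.card * ((divFam α (Y / (d₃ : ℝ) ^ 2) 1 d₃ d₄.primeFactors ∅).ncard : ℝ) := by
          exact_mod_cast h1
      _ ≤ 3 ^ d₃.primeFactors.card * (A * (3 * 4 + 2) ^ d₄.primeFactors.card * (Y / (d₃ : ℝ) ^ 2) / (d₄ : ℝ) ^ 4) :=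
          mul_le_mul_of_nonneg_left hrec (by positivity)
      _ = _ := by rw [hA]; field_simp; norm_num; ring
  · -- hstep
    intro Y' m P p hsub hp hdvd
    have hpp : p.Prime := hpf4 p (hsub hp)
    haveI := Fact.mk hpp
    have hmP : m.Coprime (∏ ℓ ∈ P, ℓ) := coprime_of_mul_dvd_prod_primes hpf4 hdvd
    have hpm : p.Coprime m := (Nat.Coprime.coprime_dvd_right (Finset.dvd_prod_of_mem _ hp) hmP).symm
    have hpd4 : p ∣ d₄ := Nat.dvd_of_mem_primeFactors (hsub hp)
    have hpt : p.Coprime d₃ := Nat.Coprime.coprime_dvd_left hpd4 h43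
    have h := ncard_divFam_P4_step (s := α) (Y := Y') (m := m) (t := d₃) (P4 := P) (P3 := ∅) p
      (fun ℓ hℓ => hpf4 ℓ (hsub hℓ)) (fun ℓ hℓ => absurd hℓ (Finset.notMem_empty ℓ)) hp (Finset.notMem_empty p) hpm hpt
    have h' : ((divFam α Y' m d₃ P ∅).ncard : ℝ) ≤
        (((divFam α (Y' / (p : ℝ) ^ 4) m d₃ (P.erase p) ∅).ncard +
          3 * (divFam α (Y' / (p : ℝ) ^ 2) (m * p) d₃ (P.erase p) ∅).ncard +
          (p + 1) * (divFam α (Y' / (p : ℝ) ^ 6) m d₃ (P.erase p) ∅).ncard : ℕ) : ℝ) := by exact_mod_cast h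
    push_cast at h'
    exact h'
  · -- hterm
    intro Y' m hm hKY _
    have hsqm : Squarefree m := hsq4.squarefree_of_dvd (by rw [hd4] at hm; exact hm)
    rw [hd4] at hm
    have hm3 : m.Coprime d₃ := Nat.Coprime.coprime_dvd_left hm h43
    have hm36 : (m * d₃).Coprime 6 := Nat.Coprime.coprime_dvd_left (Nat.mul_dvd_mul_right hm d₃) h436
    have hm0 : (0 : ℝ) < m := by exact_mod_cast Nat.pos_of_ne_zero hsqm.ne_zero
    have hth : K_B * ((m : ℝ) ^ 2 * d₃) ^ 5 ≤ Y' := by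
      calc K_B * ((m : ℝ) ^ 2 * d₃) ^ 5 = K_B * (d₃ : ℝ) ^ 5 * (m : ℝ) ^ 10 := by ring
        _ ≤ Y' := hKY
    have h := hLT α hα m d₃ hsqm hsq3 hm3 hm36 Y' hth
    rw [Nat.Coprime.primeFactors_mul hm3, Finset.card_union_of_disjoint (Nat.Coprime.disjoint_primeFactors hm3),
      pow_add] at h
    calc ((divFam α Y' m d₃ ∅ ∅).ncard : ℝ) ≤ C_B * (4 ^ m.primeFactors.card * 4 ^ d₃.primeFactors.card) * Y' /
          ((m : ℝ) ^ 2 * d₃) := h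
      _ = A * 4 ^ m.primeFactors.card * Y' / (m : ℝ) ^ 2 := by rw [hA]; field_simp
  · -- threshold
    rw [Nat.cast_one, one_pow, mul_one, hd4, le_div_iff₀ (pow_pos hd30 2)]
    calc K_B * (d₃ : ℝ) ^ 5 * (d₄ : ℝ) ^ 16 * (d₃ : ℝ) ^ 2 = K_B * (d₃ : ℝ) ^ 7 * (d₄ : ℝ) ^ 16 := by ring
      _ ≤ Y := hY
  · exact div_le_self (le_trans (by positivity) hY) (one_le_pow₀ (by exact_mod_cast Nat.pos_of_ne_zero hsq3.ne_zero))

/-! #### Small regime: sums over a block of `d₃` -/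

/-- The `d₃`-summed count: `Σ_{d ∈ D} #divFam α Y m d P ∅`. [folklore] -/
def blockSum (α : ℤ) (D : Finset ℕ) (Y : ℝ) (m : ℕ) (P : Finset ℕ) : ℝ :=
  ∑ d ∈ D, ((divFam α Y m d P ∅).ncard : ℝ)

/-- The number of `d ∈ D` dividing a nonzero integer is at most its number of divisors. [folklore] -/
theorem card_filter_dvd_le_card_divisors (D : Finset ℕ) {n : ℤ} (hn : n ≠ 0) :
    (D.filter (fun d : ℕ => (d : ℤ) ∣ n)).card ≤ n.natAbs.divisors.card := by
  refine Finset.card_le_card_of_injOn (fun d => d) (fun d hd => ?_) (fun _ _ _ _ h => h)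
  rw [Finset.mem_coe, Finset.mem_filter] at hd
  rw [Finset.mem_coe, Nat.mem_divisors]
  exact ⟨Int.natCast_dvd.mp hd.2, Int.natAbs_ne_zero.mpr hn⟩

/-- **The divisor bound inside the block sum**: `blockSum α D Y m ∅ ≤ max_{0<|n|<Y} τ(n) · #divFam α Y m 1 ∅ ∅`, here with
`τ(n) ≤ C_δ n^δ ≤ C_δ Y^δ` ("for each fixed `x'` in the inner sum, there are at most `O(Q^ε)` such `d₃` with
`d₃ ∣ Disc(x')`"). [cite: BhargavaTaniguchiThorne2023, §5 (N ≤ Q^{100}: the divisor bound over the dyadic block [D₃, 2D₃])] -/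
theorem blockSum_empty_le {Cδ δ : ℝ} (hδ : 0 < δ) (hCδ : ∀ n : ℕ, ((n.divisors.card : ℕ) : ℝ) ≤ Cδ * (n : ℝ) ^ δ)
    {α : ℤ} (hα : α = 1 ∨ α = -1) (D : Finset ℕ) (Y : ℝ) (m : ℕ) :
    blockSum α D Y m ∅ ≤ Cδ * Y ^ δ * ((divFam α Y m 1 ∅ ∅).ncard : ℝ) := by
  set S := divFam α Y m 1 ∅ ∅ with hS
  have hfin : S.Finite := divFam_finite _ _ _ _ _ _
  have hCδ0 : 0 ≤ Cδ := by
    have h := hCδ 1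
    simp at h
    linarith
  -- each summand is the size of a subfamily cut out by `d ∣ Disc`
  have hsub : ∀ d ∈ D, ((divFam α Y m d ∅ ∅).ncard : ℝ) ≤
      ((hfin.toFinset.filter (fun O => (d : ℤ) ∣ (repOf O).disc)).card : ℝ) := by
    intro d _
    have : divFam α Y m d ∅ ∅ ⊆ ↑(hfin.toFinset.filter (fun O => (d : ℤ) ∣ (repOf O).disc)) := by
      intro O hO
      obtain ⟨hrep, hc⟩ := repOf_of_mem_divFam hO
      rw [Finset.mem_coe, Finset.mem_filter, Set.Finite.mem_toFinset]
      exact ⟨⟨repOf O, hrep, hc.1, hc.2.1, by simp, hc.2.2.2⟩, hc.2.2.1⟩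
    exact_mod_cast (Set.ncard_le_ncard this (Finset.finite_toSet _)).trans_eq (Set.ncard_coe_finset _)
  -- per orbit, the number of `d ∈ D` dividing `Disc` is at most `τ(|Disc|) ≤ Cδ Y^δ`
  have hτ : ∀ O ∈ hfin.toFinset, ((D.filter (fun d : ℕ => (d : ℤ) ∣ (repOf O).disc)).card : ℝ) ≤ Cδ * Y ^ δ := by
    intro O hO
    rw [Set.Finite.mem_toFinset] at hO
    obtain ⟨-, ⟨h0, hlt⟩, -⟩ := repOf_of_mem_divFam hO
    have hn0 : (repOf O).disc ≠ 0 := by rintro h; rw [h, mul_zero] at h0; exact lt_irrefl _ h0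
    have habs : (((repOf O).disc.natAbs : ℕ) : ℝ) ≤ Y := by
      have h1 : ((repOf O).disc.natAbs : ℤ) = α * (repOf O).disc := by
        rcases hα with rfl | rfl
        · rw [one_mul] at h0 ⊢; exact Int.natAbs_of_nonneg h0.le
        · have : (repOf O).disc < 0 := by linarith
          rw [Int.ofNat_natAbs_of_nonpos this.le]; ring
      have h2 : (((repOf O).disc.natAbs : ℤ) : ℝ) < Y := by rw [h1]; exact hlt
      rw [Int.cast_natCast] at h2
      exact h2.le
    calc ((D.filter (fun d : ℕ => (d : ℤ) ∣ (repOf O).disc)).card : ℝ)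
        ≤ (((repOf O).disc.natAbs.divisors.card : ℕ) : ℝ) := by
          exact_mod_cast card_filter_dvd_le_card_divisors D hn0
      _ ≤ Cδ * (((repOf O).disc.natAbs : ℕ) : ℝ) ^ δ := hCδ _
      _ ≤ Cδ * Y ^ δ := mul_le_mul_of_nonneg_left (Real.rpow_le_rpow (Nat.cast_nonneg _) habs hδ.le) hCδ0
  calc blockSum α D Y m ∅ = ∑ d ∈ D, ((divFam α Y m d ∅ ∅).ncard : ℝ) := rfl
    _ ≤ ∑ d ∈ D, ((hfin.toFinset.filter (fun O => (d : ℤ) ∣ (repOf O).disc)).card : ℝ) := Finset.sum_le_sum hsub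
    _ = ∑ d ∈ D, ∑ O ∈ hfin.toFinset, (if (d : ℤ) ∣ (repOf O).disc then (1 : ℝ) else 0) := by
        refine Finset.sum_congr rfl fun d _ => ?_
        rw [Finset.natCast_card_filter]
    _ = ∑ O ∈ hfin.toFinset, ∑ d ∈ D, (if (d : ℤ) ∣ (repOf O).disc then (1 : ℝ) else 0) := Finset.sum_comm
    _ = ∑ O ∈ hfin.toFinset, ((D.filter (fun d : ℕ => (d : ℤ) ∣ (repOf O).disc)).card : ℝ) := by
        refine Finset.sum_congr rfl fun O _ => ?_
        rw [Finset.natCast_card_filter]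
    _ ≤ ∑ _O ∈ hfin.toFinset, Cδ * Y ^ δ := Finset.sum_le_sum hτ
    _ = Cδ * Y ^ δ * (S.ncard : ℝ) := by
        rw [Finset.sum_const, nsmul_eq_mul, Set.ncard_eq_toFinset_card S hfin]; ring

/-- **The window count with `m² ∣ Disc` from Prop. 4.5** (`btt_uniformity_sqDvd` with constant `C_U`):
`#divFam α Y m 1 ∅ ∅ ≤ C_U 6^{ω(m)} ⌈Y⌉₊/m²` for squarefree `m`. [cite: BhargavaTaniguchiThorne2023, Prop. 4.5] -/
theorem ncard_divFam_empty_le_of_uniformity {C_U : ℝ}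
    (hC : ∀ q : ℕ, Squarefree q → ∀ s : ℤ, (s = 1 ∨ s = -1) → ∀ X : ℕ,
      (((∑ D ∈ (discWindow s X).filter (fun D => (q : ℤ) ^ 2 ∣ D), classNumber D : ℕ) : ℝ))
        ≤ C_U * 6 ^ q.primeFactors.card * X / (q : ℝ) ^ 2)
    {α : ℤ} (hα : α = 1 ∨ α = -1) {m : ℕ} (hm : Squarefree m) (Y : ℝ) :
    ((divFam α Y m 1 ∅ ∅).ncard : ℝ) ≤ C_U * 6 ^ m.primeFactors.card * (⌈Y⌉₊ : ℝ) / (m : ℝ) ^ 2 := by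
  have hsub : divFam α Y m 1 ∅ ∅ ⊆ maxOrbits ∅ α (⌈Y⌉₊ : ℕ) m := by
    rintro O ⟨f, hO, ⟨h0, hlt⟩, hm2, -, -, -⟩
    exact ⟨f, hO, ⟨h0, hlt.trans_le (Nat.le_ceil Y)⟩, hm2, fun ℓ hℓ => absurd hℓ (Finset.notMem_empty ℓ)⟩
  calc ((divFam α Y m 1 ∅ ∅).ncard : ℝ) ≤ ((maxOrbits ∅ α (⌈Y⌉₊ : ℕ) m).ncard : ℝ) := by
        exact_mod_cast Set.ncard_le_ncard hsub (maxOrbits_finite _ _ _ _)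
    _ = (((∑ D ∈ (discWindow α ⌈Y⌉₊).filter (fun D => ((m : ℕ) : ℤ) ^ 2 ∣ D), classNumber D : ℕ) : ℝ)) := by
        rw [ncard_maxOrbits_empty hα ⌈Y⌉₊ m]
    _ ≤ C_U * 6 ^ m.primeFactors.card * (⌈Y⌉₊ : ℝ) / (m : ℝ) ^ 2 := hC m hm α hα ⌈Y⌉₊

/-- The constant of a uniformity bound is nonnegative. [folklore] -/
theorem nonneg_of_uniformity_const {C_U : ℝ}
    (hC : ∀ q : ℕ, Squarefree q → ∀ s : ℤ, (s = 1 ∨ s = -1) → ∀ X : ℕ,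
      (((∑ D ∈ (discWindow s X).filter (fun D => (q : ℤ) ^ 2 ∣ D), classNumber D : ℕ) : ℝ))
        ≤ C_U * 6 ^ q.primeFactors.card * X / (q : ℝ) ^ 2) : 0 ≤ C_U := by
  have h1 := hC 1 squarefree_one 1 (Or.inl rfl) 1
  have h0 : (0 : ℝ) ≤ ((∑ D ∈ (discWindow 1 1).filter (fun D => ((1 : ℕ) : ℤ) ^ 2 ∣ D), classNumber D : ℕ) : ℝ) :=
    Nat.cast_nonneg _
  have h2 : C_U * 6 ^ (1 : ℕ).primeFactors.card * ((1 : ℕ) : ℝ) / ((1 : ℕ) : ℝ) ^ 2 = C_U := by simp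
  linarith [h0.trans h1]

/-- Below height `1` the family is empty (`s·Disc ≥ 1`). [folklore] -/
theorem divFam_eq_empty_of_lt_one {α : ℤ} {Y : ℝ} (hY : Y < 1) (m t : ℕ) (P4 P3 : Finset ℕ) :
    divFam α Y m t P4 P3 = ∅ := by
  ext O
  simp only [Set.mem_empty_iff_false, iff_false]
  rintro ⟨f, -, ⟨h0, hlt⟩, -⟩
  have h1 : (1 : ℝ) ≤ ((α * f.disc : ℤ) : ℝ) := by exact_mod_cast h0
  linarith

/-- **The terminal bound of the small regime**: for squarefree `m` and `0 ≤ Y ≤ Y_cap`,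
`blockSum α D Y m ∅ ≤ (2 C_δ Y_cap^δ C_U) · 6^{ω(m)} · Y/m²` (divisor bound × Prop. 4.5; empty below `Y = 1`,
`⌈Y⌉₊ ≤ 2Y` above). [folklore] -/
theorem blockSum_empty_le_terminal {Cδ δ C_U : ℝ} (hδ : 0 < δ) (hCδ : ∀ n : ℕ, ((n.divisors.card : ℕ) : ℝ) ≤ Cδ * (n : ℝ) ^ δ)
    (hC : ∀ q : ℕ, Squarefree q → ∀ s : ℤ, (s = 1 ∨ s = -1) → ∀ X : ℕ,
      (((∑ D ∈ (discWindow s X).filter (fun D => (q : ℤ) ^ 2 ∣ D), classNumber D : ℕ) : ℝ))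
        ≤ C_U * 6 ^ q.primeFactors.card * X / (q : ℝ) ^ 2)
    {α : ℤ} (hα : α = 1 ∨ α = -1) (D : Finset ℕ) {m : ℕ} (hm : Squarefree m) {Y Ycap : ℝ} (hY0 : 0 ≤ Y) (hYc : Y ≤ Ycap) :
    blockSum α D Y m ∅ ≤ (2 * Cδ * Ycap ^ δ * C_U) * 6 ^ m.primeFactors.card * Y / (m : ℝ) ^ 2 := by
  have hCδ0 : 0 ≤ Cδ := by
    have h := hCδ 1; simp at h; linarith
  have hCU0 : 0 ≤ C_U := nonneg_of_uniformity_const hC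
  have hYcδ : 0 ≤ Ycap ^ δ := Real.rpow_nonneg (hY0.trans hYc) δ
  by_cases hY1 : Y < 1
  · have : blockSum α D Y m ∅ = 0 := by
      unfold blockSum
      refine Finset.sum_eq_zero fun d _ => ?_
      rw [divFam_eq_empty_of_lt_one hY1, Set.ncard_empty, Nat.cast_zero]
    rw [this]
    positivity
  push Not at hY1
  have hceil : (⌈Y⌉₊ : ℝ) ≤ 2 * Y := by
    have := Nat.ceil_lt_add_one hY0
    linarith
  have hm0 : (0 : ℝ) < m := by exact_mod_cast Nat.pos_of_ne_zero hm.ne_zero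
  calc blockSum α D Y m ∅ ≤ Cδ * Y ^ δ * ((divFam α Y m 1 ∅ ∅).ncard : ℝ) := blockSum_empty_le hδ hCδ hα D Y m
    _ ≤ Cδ * Y ^ δ * (C_U * 6 ^ m.primeFactors.card * (⌈Y⌉₊ : ℝ) / (m : ℝ) ^ 2) :=
        mul_le_mul_of_nonneg_left (ncard_divFam_empty_le_of_uniformity hC hα hm Y) (by positivity)
    _ ≤ Cδ * Ycap ^ δ * (C_U * 6 ^ m.primeFactors.card * (2 * Y) / (m : ℝ) ^ 2) := by
        have hYδ : Y ^ δ ≤ Ycap ^ δ := Real.rpow_le_rpow hY0 hYc hδ.le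
        have h2 : C_U * 6 ^ m.primeFactors.card * (⌈Y⌉₊ : ℝ) / (m : ℝ) ^ 2 ≤
            C_U * 6 ^ m.primeFactors.card * (2 * Y) / (m : ℝ) ^ 2 := by
          rw [div_le_div_iff_of_pos_right (pow_pos hm0 2)]
          exact mul_le_mul_of_nonneg_left hceil (by positivity)
        have h3 : 0 ≤ C_U * 6 ^ m.primeFactors.card * (2 * Y) / (m : ℝ) ^ 2 := by positivity
        calc Cδ * Y ^ δ * (C_U * 6 ^ m.primeFactors.card * (⌈Y⌉₊ : ℝ) / (m : ℝ) ^ 2)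
            ≤ Cδ * Y ^ δ * (C_U * 6 ^ m.primeFactors.card * (2 * Y) / (m : ℝ) ^ 2) :=
              mul_le_mul_of_nonneg_left h2 (mul_nonneg hCδ0 (Real.rpow_nonneg hY0 δ))
          _ ≤ Cδ * Ycap ^ δ * (C_U * 6 ^ m.primeFactors.card * (2 * Y) / (m : ℝ) ^ 2) :=
              mul_le_mul_of_nonneg_right (mul_le_mul_of_nonneg_left hYδ hCδ0) h3
    _ = (2 * Cδ * Ycap ^ δ * C_U) * 6 ^ m.primeFactors.card * Y / (m : ℝ) ^ 2 := by ring

/-- **Small regime, one block**: for `d₄` squarefree and a set `D` of numbers prime to `d₄`, and `0 ≤ Y ≤ Y_cap`,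
`Σ_{d₃ ∈ D} #divFam α Y 1 d₃ P₄ ∅ ≤ (2 C_δ Y_cap^δ C_U) · 20^{ω(d₄)} · Y/d₄⁴` — the `P₄`-recursion run on the block sum,
with the terminal bound from the divisor bound and Prop. 4.5 (`K = 0`).
[cite: BhargavaTaniguchiThorne2023, §5 (N ≤ Q^{100}: the dyadic blocks [D₃, 2D₃] and Prop. 4.5)] -/
theorem blockSum_le {Cδ δ C_U : ℝ} (hδ : 0 < δ) (hCδ : ∀ n : ℕ, ((n.divisors.card : ℕ) : ℝ) ≤ Cδ * (n : ℝ) ^ δ)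
    (hC : ∀ q : ℕ, Squarefree q → ∀ s : ℤ, (s = 1 ∨ s = -1) → ∀ X : ℕ,
      (((∑ D ∈ (discWindow s X).filter (fun D => (q : ℤ) ^ 2 ∣ D), classNumber D : ℕ) : ℝ))
        ≤ C_U * 6 ^ q.primeFactors.card * X / (q : ℝ) ^ 2)
    {α : ℤ} (hα : α = 1 ∨ α = -1) {d₄ : ℕ} (hd4 : Squarefree d₄) (D : Finset ℕ) (hD : ∀ d ∈ D, d.Coprime d₄)
    {Y Ycap : ℝ} (hY0 : 0 ≤ Y) (hYc : Y ≤ Ycap) :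
    blockSum α D Y 1 d₄.primeFactors ≤ (2 * Cδ * Ycap ^ δ * C_U) * 20 ^ d₄.primeFactors.card * Y / (d₄ : ℝ) ^ 4 := by
  have hCδ0 : 0 ≤ Cδ := by
    have h := hCδ 1; simp at h; linarith
  have hCU0 : 0 ≤ C_U := nonneg_of_uniformity_const hC
  have hYc0 : 0 ≤ Ycap := hY0.trans hYc
  have hYcδ : 0 ≤ Ycap ^ δ := Real.rpow_nonneg hYc0 δ
  have hpf4 : ∀ ℓ ∈ d₄.primeFactors, ℓ.Prime := fun ℓ hℓ => Nat.prime_of_mem_primeFactors hℓ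
  have hd4' : ∏ p ∈ d₄.primeFactors, p = d₄ := Nat.prod_primeFactors_of_squarefree hd4
  set A : ℝ := 2 * Cδ * Ycap ^ δ * C_U with hA
  have hA0 : 0 ≤ A := by rw [hA]; exact mul_nonneg (mul_nonneg (mul_nonneg (by norm_num) hCδ0) hYcδ) hCU0
  have hrec := abstract_recursion_P4 (fun Y' m P => blockSum α D Y' m P) hA0 (show (1 : ℝ) ≤ 6 by norm_num) le_rfl
    d₄.primeFactors hpf4 ?_ Ycap ?_ d₄.primeFactors Y 1 subset_rfl (by rw [one_mul]) (by simpa using hY0) hYc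
  · rw [hd4', Nat.primeFactors_one, Finset.card_empty, pow_zero, mul_one, Nat.cast_one, one_pow, one_mul] at hrec
    calc blockSum α D Y 1 d₄.primeFactors ≤ A * (3 * 6 + 2) ^ d₄.primeFactors.card * Y / (d₄ : ℝ) ^ 4 := hrec
      _ = A * 20 ^ d₄.primeFactors.card * Y / (d₄ : ℝ) ^ 4 := by norm_num
  · -- hstep: sum the per-`d₃` steps
    intro Y' m P p hsub hp hdvd
    have hpp : p.Prime := hpf4 p (hsub hp)
    haveI := Fact.mk hpp
    have hmP : m.Coprime (∏ ℓ ∈ P, ℓ) := coprime_of_mul_dvd_prod_primes hpf4 hdvd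
    have hpm : p.Coprime m := (Nat.Coprime.coprime_dvd_right (Finset.dvd_prod_of_mem _ hp) hmP).symm
    have hpd4 : p ∣ d₄ := Nat.dvd_of_mem_primeFactors (hsub hp)
    unfold blockSum
    rw [Finset.mul_sum, Finset.mul_sum, ← Finset.sum_add_distrib, ← Finset.sum_add_distrib]
    refine Finset.sum_le_sum fun d hd => ?_
    have hpt : p.Coprime d := Nat.Coprime.coprime_dvd_left hpd4 (hD d hd).symm
    have h := ncard_divFam_P4_step (s := α) (Y := Y') (m := m) (t := d) (P4 := P) (P3 := ∅) p
      (fun ℓ hℓ => hpf4 ℓ (hsub hℓ)) (fun ℓ hℓ => absurd hℓ (Finset.notMem_empty ℓ)) hp (Finset.notMem_empty p) hpm hpt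
    have h' : ((divFam α Y' m d P ∅).ncard : ℝ) ≤
        (((divFam α (Y' / (p : ℝ) ^ 4) m d (P.erase p) ∅).ncard +
          3 * (divFam α (Y' / (p : ℝ) ^ 2) (m * p) d (P.erase p) ∅).ncard +
          (p + 1) * (divFam α (Y' / (p : ℝ) ^ 6) m d (P.erase p) ∅).ncard : ℕ) : ℝ) := by exact_mod_cast h
    push_cast at h'
    exact h'
  · -- hterm
    intro Y' m hm hKY hYc'
    rw [hd4'] at hm
    rw [zero_mul] at hKY
    exact blockSum_empty_le_terminal hδ hCδ hC hα D (hd4.squarefree_of_dvd hm) hKY hYc'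

end Regimes

/-! ### The primes `≥ 5` of `q`, admissible types, and the large regime per `q` -/

section FinalOne

/-- The primes `p ≥ 5` dividing `q` (the primes `2, 3` are absorbed in the constants). [folklore] -/
def bigPrimes (q : ℕ) : Finset ℕ := q.primeFactors.filter (fun p => 5 ≤ p)

/-- The `5`-rough part `u(q) = ∏_{p ∣ q, p ≥ 5} p` of (squarefree) `q`. [folklore] -/
def roughPart (q : ℕ) : ℕ := ∏ p ∈ bigPrimes q, p

/-- Members of `bigPrimes q` are prime. [folklore] -/
theorem prime_of_mem_bigPrimes {q p : ℕ} (hp : p ∈ bigPrimes q) : p.Prime :=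
  Nat.prime_of_mem_primeFactors (Finset.mem_filter.mp hp).1

/-- Members of `bigPrimes q` are `≥ 5`. [folklore] -/
theorem five_le_of_mem_bigPrimes {q p : ℕ} (hp : p ∈ bigPrimes q) : 5 ≤ p := (Finset.mem_filter.mp hp).2

/-- `u(q) > 0`. [folklore] -/
theorem roughPart_pos (q : ℕ) : 0 < roughPart q := Finset.prod_pos fun _ hp => (prime_of_mem_bigPrimes hp).pos

/-- `u(q)` is squarefree. [folklore] -/
theorem squarefree_roughPart (q : ℕ) : Squarefree (roughPart q) :=
  squarefree_prod_of_primes fun _ hp => prime_of_mem_bigPrimes hp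

/-- `u(q)` is prime to `6`. [folklore] -/
theorem coprime_six_roughPart (q : ℕ) : (roughPart q).Coprime 6 := by
  refine Nat.Coprime.prod_left fun p hp => ?_
  have hpr := prime_of_mem_bigPrimes hp
  have h5 := five_le_of_mem_bigPrimes hp
  rw [show (6 : ℕ) = 2 * 3 by norm_num]
  exact Nat.Coprime.mul_right ((Nat.coprime_primes hpr Nat.prime_two).mpr (by omega))
    ((Nat.coprime_primes hpr Nat.prime_three).mpr (by omega))

/-- `u(q) ∣ q` for squarefree `q`. [folklore] -/
theorem roughPart_dvd {q : ℕ} (hq : Squarefree q) : roughPart q ∣ q := by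
  conv_rhs => rw [← Nat.prod_primeFactors_of_squarefree hq]
  exact Finset.prod_dvd_prod_of_subset _ _ _ (Finset.filter_subset _ _)

/-- `q ≤ 6 u(q)` for squarefree `q` (the primes below `5` contribute a divisor of `6`). [folklore] -/
theorem le_six_mul_roughPart {q : ℕ} (hq : Squarefree q) : q ≤ 6 * roughPart q := by
  have hsplit : q = (∏ p ∈ q.primeFactors.filter (fun p => ¬ 5 ≤ p), p) * roughPart q := by
    conv_lhs => rw [← Nat.prod_primeFactors_of_squarefree hq]
    rw [roughPart, bigPrimes, mul_comm, Finset.prod_filter_mul_prod_filter_not]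
  have hsub : q.primeFactors.filter (fun p => ¬ 5 ≤ p) ⊆ ({2, 3} : Finset ℕ) := by
    intro p hp
    obtain ⟨hp1, hp2⟩ := Finset.mem_filter.mp hp
    have hpr := Nat.prime_of_mem_primeFactors hp1
    have h2 := hpr.two_le
    have : p = 2 ∨ p = 3 := by
      interval_cases p
      · exact Or.inl rfl
      · exact Or.inr rfl
      · exact absurd hpr (by decide)
    rcases this with rfl | rfl <;> simp
  have hsmall : ∏ p ∈ q.primeFactors.filter (fun p => ¬ 5 ≤ p), p ≤ 6 :=
    calc ∏ p ∈ q.primeFactors.filter (fun p => ¬ 5 ≤ p), p ≤ ∏ p ∈ ({2, 3} : Finset ℕ), p :=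
          Finset.prod_le_prod_of_subset_of_one_le' hsub fun p hp _ => by
            simp only [Finset.mem_insert, Finset.mem_singleton] at hp; omega
      _ = 6 := (Finset.prod_pair (show (2 : ℕ) ≠ 3 by norm_num)).trans (by norm_num)
  calc q = (∏ p ∈ q.primeFactors.filter (fun p => ¬ 5 ≤ p), p) * roughPart q := hsplit
    _ ≤ 6 * roughPart q := Nat.mul_le_mul_right _ hsmall

/-- At most `τ(u)³` types `τ ∈ [1,B]⁴` have product `u` (the first three coordinates are divisors and determine
the fourth). [folklore] -/
theorem card_tupleBox_filter_prod_le (B : ℕ) {u : ℕ} (hu : u ≠ 0) :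
    ((tupleBox B).filter (fun τ => τ.1 * τ.2.1 * τ.2.2.1 * τ.2.2.2 = u)).card ≤ u.divisors.card ^ 3 := by
  have hcard : u.divisors.card ^ 3 = (u.divisors ×ˢ (u.divisors ×ˢ u.divisors)).card := by
    simp [Finset.card_product]; ring
  rw [hcard]
  refine Finset.card_le_card_of_injOn (fun τ => (τ.1, τ.2.1, τ.2.2.1)) ?_ ?_
  · intro τ hτ
    obtain ⟨-, hτu⟩ := Finset.mem_filter.mp (Finset.mem_coe.mp hτ)
    simp only [Finset.coe_product, Set.mem_prod, Finset.mem_coe, Nat.mem_divisors]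
    exact ⟨⟨⟨τ.2.1 * τ.2.2.1 * τ.2.2.2, by rw [← hτu]; ring⟩, hu⟩, ⟨⟨τ.1 * τ.2.2.1 * τ.2.2.2, by rw [← hτu]; ring⟩, hu⟩,
      ⟨⟨τ.1 * τ.2.1 * τ.2.2.2, by rw [← hτu]; ring⟩, hu⟩⟩
  · intro τ hτ τ' hτ' h
    obtain ⟨-, hτu⟩ := Finset.mem_filter.mp (Finset.mem_coe.mp hτ)
    obtain ⟨-, hτu'⟩ := Finset.mem_filter.mp (Finset.mem_coe.mp hτ')
    simp only [Prod.mk.injEq] at h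
    obtain ⟨h1, h2, h3⟩ := h
    have hne : τ.1 * τ.2.1 * τ.2.2.1 ≠ 0 := by
      intro h0; apply hu; rw [← hτu, h0, zero_mul]
    have h4 : τ.2.2.2 = τ'.2.2.2 := by
      apply Nat.eq_of_mul_eq_mul_left (Nat.pos_of_ne_zero hne)
      rw [hτu]
      rw [h1, h2, h3, hτu']
    exact Prod.ext h1 (Prod.ext h2 (Prod.ext h3 h4))

/-- `ω(c₁) + ω(d₄) + ω(d₃) ≤ ω(u)` for `u = c₂c₁d₄d₃` squarefree. [folklore] -/
theorem card_primeFactors_parts_le {c₂ c₁ d₄ d₃ : ℕ} (hsq : Squarefree (c₂ * c₁ * d₄ * d₃)) :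
    c₁.primeFactors.card + d₄.primeFactors.card + d₃.primeFactors.card ≤ (c₂ * c₁ * d₄ * d₃).primeFactors.card := by
  obtain ⟨h123_3, h123, -⟩ := Nat.squarefree_mul_iff.mp hsq
  obtain ⟨h12_4, h12, -⟩ := Nat.squarefree_mul_iff.mp h123
  obtain ⟨h1_2, -, -⟩ := Nat.squarefree_mul_iff.mp h12
  rw [Nat.Coprime.primeFactors_mul h123_3, Finset.card_union_of_disjoint (Nat.Coprime.disjoint_primeFactors h123_3),
    Nat.Coprime.primeFactors_mul h12_4, Finset.card_union_of_disjoint (Nat.Coprime.disjoint_primeFactors h12_4),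
    Nat.Coprime.primeFactors_mul h1_2, Finset.card_union_of_disjoint (Nat.Coprime.disjoint_primeFactors h1_2)]
  omega

/-- The count term of type `τ` at height `N`, both signs:
`Σ_α #divFam α (N/(c₂²c₁)⁴) 1 1 P₄ P₃`. [folklore] -/
def cntBoth (τ : ℕ × ℕ × ℕ × ℕ) (N : ℝ) : ℝ :=
  ((divFam 1 (N / ((τ.1 ^ 2 * τ.2.1 : ℕ) : ℝ) ^ 4) 1 1 τ.2.2.1.primeFactors τ.2.2.2.primeFactors).ncard : ℝ) +
  ((divFam (-1) (N / ((τ.1 ^ 2 * τ.2.1 : ℕ) : ℝ) ^ 4) 1 1 τ.2.2.1.primeFactors τ.2.2.2.primeFactors).ncard : ℝ)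

/-- The count term is nonnegative. [folklore] -/
theorem cntBoth_nonneg (τ : ℕ × ℕ × ℕ × ℕ) (N : ℝ) : 0 ≤ cntBoth τ N := by
  unfold cntBoth; positivity

/-- **Large regime, one type: the full term `wt(τ)·cnt(τ) ≤ 2 C_B 14^{ω(u)} N/u⁷`** (`u = ∏τ`, all exponents `≥ 7`).
[cite: BhargavaTaniguchiThorne2023, §5 (eq. (39): N/(c₂^{10} c₁⁷ d_{4c}⁸ d_{4n}⁷ D₃⁶ d₂⁷), all exponents ≥ 7 in the large regime)] -/
theorem weight_mul_cnt_large_le {C_B K_B : ℝ} (hLT : DivCountBound C_B K_B) (hC : 0 ≤ C_B) (hK : 0 ≤ K_B)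
    {P : Finset ℕ} (hP : ∀ p ∈ P, p.Prime) (h6 : (∏ p ∈ P, p).Coprime 6)
    {τ : ℕ × ℕ × ℕ × ℕ} (hprod : τ.1 * τ.2.1 * τ.2.2.1 * τ.2.2.2 = ∏ p ∈ P, p)
    {B : ℕ} (hB : ∏ p ∈ P, p ≤ B) {N : ℝ} (hN : K_B * (B : ℝ) ^ 35 ≤ N) :
    tupleWeight τ * cntBoth τ N ≤ 2 * C_B * 14 ^ (∏ p ∈ P, p).primeFactors.card * N / ((∏ p ∈ P, p : ℕ) : ℝ) ^ 7 := by
  obtain ⟨c₂, c₁, d₄, d₃⟩ := τ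
  dsimp only at hprod ⊢
  set u : ℕ := ∏ p ∈ P, p with hu
  have hsq : Squarefree (c₂ * c₁ * d₄ * d₃) := hprod ▸ squarefree_prod_of_primes hP
  have hu0 : u ≠ 0 := by rw [← hprod]; exact hsq.ne_zero
  -- each component divides `u`, hence is `≥ 1` and `≤ B`
  have hcomp : ∀ x : ℕ, x ∣ c₂ * c₁ * d₄ * d₃ → 1 ≤ x ∧ (x : ℝ) ≤ B := fun x hx => by
    have hx0 : x ≠ 0 := fun h => hsq.ne_zero (zero_dvd_iff.mp (h ▸ hx))
    refine ⟨Nat.one_le_iff_ne_zero.mpr hx0, ?_⟩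
    have : x ≤ u := Nat.le_of_dvd (Nat.pos_of_ne_zero hu0) (hprod ▸ hx)
    exact_mod_cast this.trans hB
  obtain ⟨h2l, h2B⟩ := hcomp c₂ ⟨c₁ * d₄ * d₃, by ring⟩
  obtain ⟨h1l, h1B⟩ := hcomp c₁ ⟨c₂ * d₄ * d₃, by ring⟩
  obtain ⟨h4l, h4B⟩ := hcomp d₄ ⟨c₂ * c₁ * d₃, by ring⟩
  obtain ⟨h3l, h3B⟩ := hcomp d₃ ⟨c₂ * c₁ * d₄, by ring⟩
  have h2r : (1 : ℝ) ≤ c₂ := by exact_mod_cast h2l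
  have h1r : (1 : ℝ) ≤ c₁ := by exact_mod_cast h1l
  have h4r : (1 : ℝ) ≤ d₄ := by exact_mod_cast h4l
  have h3r : (1 : ℝ) ≤ d₃ := by exact_mod_cast h3l
  have hB0 : (0 : ℝ) ≤ B := le_trans zero_le_one (h2r.trans h2B)
  have hN0 : 0 ≤ N := le_trans (by positivity) hN
  -- the threshold of the large regime
  have hY : K_B * (d₃ : ℝ) ^ 7 * (d₄ : ℝ) ^ 16 ≤ N / ((c₂ ^ 2 * c₁ : ℕ) : ℝ) ^ 4 := by
    have hc0 : (0 : ℝ) < ((c₂ ^ 2 * c₁ : ℕ) : ℝ) ^ 4 := by positivity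
    rw [le_div_iff₀ hc0]
    calc K_B * (d₃ : ℝ) ^ 7 * (d₄ : ℝ) ^ 16 * ((c₂ ^ 2 * c₁ : ℕ) : ℝ) ^ 4
        = K_B * ((d₃ : ℝ) ^ 7 * (d₄ : ℝ) ^ 16 * (c₂ : ℝ) ^ 8 * (c₁ : ℝ) ^ 4) := by push_cast; ring
      _ ≤ K_B * ((B : ℝ) ^ 7 * (B : ℝ) ^ 16 * (B : ℝ) ^ 8 * (B : ℝ) ^ 4) := by
          refine mul_le_mul_of_nonneg_left ?_ hK
          gcongr
      _ = K_B * (B : ℝ) ^ 35 := by ring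
      _ ≤ N := hN
  have hcnt : ∀ α : ℤ, (α = 1 ∨ α = -1) →
      ((divFam α (N / ((c₂ ^ 2 * c₁ : ℕ) : ℝ) ^ 4) 1 1 d₄.primeFactors d₃.primeFactors).ncard : ℝ) ≤
        3 ^ d₃.primeFactors.card * (C_B * 4 ^ d₃.primeFactors.card * 14 ^ d₄.primeFactors.card) *
          (N / ((c₂ ^ 2 * c₁ : ℕ) : ℝ) ^ 4) / ((d₃ : ℝ) ^ 3 * (d₄ : ℝ) ^ 4) :=
    fun α hα => cnt_large_le hLT hC hK hα hP h6 hprod hY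
  -- the product of the local constants is at most `14^{ω(u)}`
  have hω := card_primeFactors_parts_le hsq
  rw [hprod] at hω
  have h14 : (9 : ℝ) ^ c₁.primeFactors.card * (3 ^ d₃.primeFactors.card * 4 ^ d₃.primeFactors.card) *
      14 ^ d₄.primeFactors.card ≤ 14 ^ u.primeFactors.card := by
    calc (9 : ℝ) ^ c₁.primeFactors.card * (3 ^ d₃.primeFactors.card * 4 ^ d₃.primeFactors.card) * 14 ^ d₄.primeFactors.card
        = 9 ^ c₁.primeFactors.card * 12 ^ d₃.primeFactors.card * 14 ^ d₄.primeFactors.card := by rw [← mul_pow]; norm_num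
      _ ≤ 14 ^ c₁.primeFactors.card * 14 ^ d₃.primeFactors.card * 14 ^ d₄.primeFactors.card := by
          gcongr <;> norm_num
      _ = 14 ^ (c₁.primeFactors.card + d₄.primeFactors.card + d₃.primeFactors.card) := by rw [← pow_add, ← pow_add]; ring_nf
      _ ≤ 14 ^ u.primeFactors.card := pow_le_pow_right₀ (by norm_num) hω
  -- the denominators: `c₂⁸ c₁⁷ d₄⁷ d₃⁷ ≥ u⁷`
  have hden : ((u : ℕ) : ℝ) ^ 7 ≤ (c₂ : ℝ) ^ 8 * (c₁ : ℝ) ^ 7 * (d₄ : ℝ) ^ 7 * (d₃ : ℝ) ^ 7 := by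
    rw [← hprod]; push_cast
    calc ((c₂ : ℝ) * c₁ * d₄ * d₃) ^ 7 = (c₂ : ℝ) ^ 7 * (c₁ : ℝ) ^ 7 * (d₄ : ℝ) ^ 7 * (d₃ : ℝ) ^ 7 := by ring
      _ ≤ (c₂ : ℝ) ^ 8 * (c₁ : ℝ) ^ 7 * (d₄ : ℝ) ^ 7 * (d₃ : ℝ) ^ 7 :=
          mul_le_mul_of_nonneg_right (mul_le_mul_of_nonneg_right (mul_le_mul_of_nonneg_right
            (pow_le_pow_right₀ h2r (by norm_num)) (by positivity)) (by positivity)) (by positivity)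
  have hu7 : (0 : ℝ) < ((u : ℕ) : ℝ) ^ 7 := by positivity
  -- assemble
  have hmain : tupleWeight (c₂, c₁, d₄, d₃) * cntBoth (c₂, c₁, d₄, d₃) N ≤
      2 * C_B * (9 ^ c₁.primeFactors.card * (3 ^ d₃.primeFactors.card * 4 ^ d₃.primeFactors.card) * 14 ^ d₄.primeFactors.card) *
        N / ((c₂ : ℝ) ^ 8 * (c₁ : ℝ) ^ 7 * (d₄ : ℝ) ^ 7 * (d₃ : ℝ) ^ 7) := by
    unfold tupleWeight cntBoth
    dsimp only
    calc 9 ^ c₁.primeFactors.card * ((c₁ : ℝ) ^ 3)⁻¹ * ((d₄ : ℝ) ^ 3)⁻¹ * ((d₃ : ℝ) ^ 4)⁻¹ *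
          (((divFam 1 (N / ((c₂ ^ 2 * c₁ : ℕ) : ℝ) ^ 4) 1 1 d₄.primeFactors d₃.primeFactors).ncard : ℝ) +
            ((divFam (-1) (N / ((c₂ ^ 2 * c₁ : ℕ) : ℝ) ^ 4) 1 1 d₄.primeFactors d₃.primeFactors).ncard : ℝ))
        ≤ 9 ^ c₁.primeFactors.card * ((c₁ : ℝ) ^ 3)⁻¹ * ((d₄ : ℝ) ^ 3)⁻¹ * ((d₃ : ℝ) ^ 4)⁻¹ *
          (2 * (3 ^ d₃.primeFactors.card * (C_B * 4 ^ d₃.primeFactors.card * 14 ^ d₄.primeFactors.card) *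
            (N / ((c₂ ^ 2 * c₁ : ℕ) : ℝ) ^ 4) / ((d₃ : ℝ) ^ 3 * (d₄ : ℝ) ^ 4))) := by
          refine mul_le_mul_of_nonneg_left ?_ (by positivity)
          have h1 := hcnt 1 (Or.inl rfl)
          have h2 := hcnt (-1) (Or.inr rfl)
          linarith
      _ = _ := by push_cast; field_simp
  calc tupleWeight (c₂, c₁, d₄, d₃) * cntBoth (c₂, c₁, d₄, d₃) N
      ≤ 2 * C_B * (9 ^ c₁.primeFactors.card * (3 ^ d₃.primeFactors.card * 4 ^ d₃.primeFactors.card) * 14 ^ d₄.primeFactors.card) *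
        N / ((c₂ : ℝ) ^ 8 * (c₁ : ℝ) ^ 7 * (d₄ : ℝ) ^ 7 * (d₃ : ℝ) ^ 7) := hmain
    _ ≤ 2 * C_B * 14 ^ u.primeFactors.card * N / ((c₂ : ℝ) ^ 8 * (c₁ : ℝ) ^ 7 * (d₄ : ℝ) ^ 7 * (d₃ : ℝ) ^ 7) := by
        gcongr
    _ ≤ 2 * C_B * 14 ^ u.primeFactors.card * N / ((u : ℕ) : ℝ) ^ 7 := by
        exact div_le_div_of_nonneg_left (by positivity) hu7 hden

/-- **Large regime per `q`: `Σ_{τ: ∏τ = u(q)} wt·cnt ≤ τ(u)³ · 2 C_B 14^{ω(u)} N/u⁷`** for `N ≥ K_B B^{35}`, `u(q) ≤ B`.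
[cite: BhargavaTaniguchiThorne2023, §5 (N > Q^{100})] -/
theorem typeSum_large_le {C_B K_B : ℝ} (hLT : DivCountBound C_B K_B) (hC : 0 ≤ C_B) (hK : 0 ≤ K_B)
    (q : ℕ) {B : ℕ} (hB : roughPart q ≤ B) {N : ℝ} (hN : K_B * (B : ℝ) ^ 35 ≤ N) :
    ∑ τ ∈ tupleBox B, (if τ.1 * τ.2.1 * τ.2.2.1 * τ.2.2.2 = roughPart q then tupleWeight τ else 0) * cntBoth τ N ≤
      ((roughPart q).divisors.card : ℝ) ^ 3 * (2 * C_B * 14 ^ (roughPart q).primeFactors.card * N / ((roughPart q : ℕ) : ℝ) ^ 7) := by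
  set u := roughPart q with hu
  have hP : ∀ p ∈ bigPrimes q, p.Prime := fun p hp => prime_of_mem_bigPrimes hp
  have hE0 : 0 ≤ 2 * C_B * 14 ^ u.primeFactors.card * N / ((u : ℕ) : ℝ) ^ 7 := by
    have hN0 : 0 ≤ N := le_trans (by positivity) hN
    positivity
  calc ∑ τ ∈ tupleBox B, (if τ.1 * τ.2.1 * τ.2.2.1 * τ.2.2.2 = u then tupleWeight τ else 0) * cntBoth τ N
      = ∑ τ ∈ (tupleBox B).filter (fun τ => τ.1 * τ.2.1 * τ.2.2.1 * τ.2.2.2 = u), tupleWeight τ * cntBoth τ N := by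
        rw [Finset.sum_filter]
        refine Finset.sum_congr rfl fun τ _ => ?_
        split_ifs <;> simp
    _ ≤ ∑ _τ ∈ (tupleBox B).filter (fun τ => τ.1 * τ.2.1 * τ.2.2.1 * τ.2.2.2 = u),
          2 * C_B * 14 ^ u.primeFactors.card * N / ((u : ℕ) : ℝ) ^ 7 := by
        refine Finset.sum_le_sum fun τ hτ => ?_
        obtain ⟨-, hτu⟩ := Finset.mem_filter.mp hτ
        exact weight_mul_cnt_large_le hLT hC hK hP (coprime_six_roughPart q) hτu hB hN
    _ = (((tupleBox B).filter (fun τ => τ.1 * τ.2.1 * τ.2.2.1 * τ.2.2.2 = u)).card : ℝ) *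
          (2 * C_B * 14 ^ u.primeFactors.card * N / ((u : ℕ) : ℝ) ^ 7) := by
        rw [Finset.sum_const, nsmul_eq_mul]
    _ ≤ (u.divisors.card : ℝ) ^ 3 * (2 * C_B * 14 ^ u.primeFactors.card * N / ((u : ℕ) : ℝ) ^ 7) := by
        refine mul_le_mul_of_nonneg_right ?_ hE0
        exact_mod_cast card_tupleBox_filter_prod_le B (roughPart_pos q).ne'

end FinalOne

end Literature.NumberTheory.CubicFields

end
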